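import Summits.QuantumFields.QCD.Theses.NestedDissectionSea
import Literature.MathematicalPhysics.QuantumFieldTheory.QCDTimeReflection
import Summits.QuantumFields.QCD.Theorems.SpectralDefectExtinctionAFBookkeeping

/-!
# Stub `stub_latticeQCDRP` of line `proper-time-quarantine` — conditional landing
(crux `Summit.QuantumFields.QCD.Theses.NestedDissectionSea.SeaFactorisationBridge`, item stmt-QuantumFields-13880)

Antiperiodic-quark site reflection positivity of lattice QCD along a regularisation whose valence masses are
eventually on the physical branch `m_f(k) > −1` and whose couplings scale asymptotically (so `β_k ≥ 0`
eventually), in the RP-positive pairing order `⟨A · ΘA⟩_AP` (lead reshape r3).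

No fermionic reflection-positivity / transfer-matrix trace formula is proved in the tree (`QCDTransferMatrix`
has no `Tr 𝕋^N` identity; `QCDTimeReflection` only DEFINES `Θ`, the antiperiodic functional and the predicate),
so the registered stub is landed CONDITIONALLY on the published theorem, the Literature named fact
`Literature.MathematicalPhysics.QuantumFieldTheory.WilsonQCDSiteReflectionPositivityAP` (Lüscher 1977;
Montvay–Münster §4.2.3; Osterwalder–Seiler 1978; Menotti–Pelissetto 1987; stated inline by this line and
relocated by the gate into `Literature/MathematicalPhysics/QuantumFieldTheory/QCDTimeReflection.lean`, p96182):

* `stub_latticeQCDRP_of_fact : WilsonQCDSiteReflectionPositivityAP → <registered signature of stub_latticeQCDRP verbatim>`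
  (registered as a stub of the crux item under that name).

What the reduction uses: (i) `β_k ≥ 0` eventually, from `(reg.scheme 0 0 0).HasAsymptoticScaling`
(`afBeta N_f Λ a_k → +∞` as `a_k → 0⁺` since `b₀(N_f) > 0` for `N_f ≤ 16` — reused from
`Theorems.SpectralDefectExtinctionAFBookkeeping` — and `b₁(N_f) ≥ 0` for `N_f ≤ 8`);
(ii) the branch hypothesis for all flavours at once (`Filter.eventually_all` over `Fin N_f`);
(iii) `1 ≤ L_k` eventually (from `a_k L_k → ∞`), hence `1 ≤ S` for every torus `S ≥ L_k`.

Numerical certificate of the pairing order and of the odd-torus / antipodal-layer bookkeeping (exact Gaussian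
Grassmann integration in the tree's conventions, kit jobs j016177 / j016188, script
`work/stubs/scratch/rp4/main.py`): the one-particle kernels `⟨ψ_v · Θψ_w⟩_U`, `⟨ψ̄_v · Θψ̄_w⟩_U` over ALL
positive-time generators are Hermitian positive semidefinite on the free hypercubic tori of sides 3, 5, 7, 9
(`m ∈ {−0.9, −0.5, 0, 1, 5}`, minimal eigenvalue `≥ −10⁻¹⁵`, i.e. zero to rounding) and in random reflection-symmetric `SU(3)`
backgrounds on `3⁴` and `5 × 3³`; baryon, meson, flavour-changing and point-split-meson Gram matrices
`⟨A_i · ΘA_j⟩` are PSD while the opposite order `⟨ΘA_j · A_i⟩` is NEGATIVE definite on baryons; the controls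
`m = −1.5` (`κ > 1/6`), time-PERIODIC quarks, and an antiperiodic layer not gauged to `1` each produce
negative eigenvalues (the test has teeth).
-/

noncomputable section

namespace Summit.QuantumFields.QCD.Cruxes.SeaFactorisationBridge.ProperTimeQuarantine

open scoped BigOperators Topology Classical MeasureTheory Matrix ComplexConjugate ComplexOrder
open Filter MeasureTheory
open Literature.MathematicalPhysics.QuantumFieldTheory Literature.MathematicalPhysics.QuantumLattice
open Literature.Probability.LatticeModels

/-! The published input `WilsonQCDSiteReflectionPositivityAP` (Lüscher 1977; Montvay–Münster §4.2.3; Osterwalder–Seiler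
1978; Menotti–Pelissetto 1987) was stated inline here and relocated by the gate to
`Literature/MathematicalPhysics/QuantumFieldTheory/QCDTimeReflection.lean` (p96182, commit b1733d3a0e3f); it is
referenced below by name. -/

/-! ## Elementary inputs: `β_k ≥ 0`, all flavours on the branch, `1 ≤ L_k`, eventually -/

/-- `b₁(N_f) = (102 − 38N_f/3)/(16π²)² ≥ 0` for `N_f ≤ 8`. -/
theorem betaCoeff₁_nonneg_of_le_eight' {Nf : ℕ} (hNf : Nf ≤ 8) : 0 ≤ betaCoeff₁ Nf := by
  unfold betaCoeff₁
  have h : (Nf : ℝ) ≤ 8 := by exact_mod_cast hNf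
  have hπ : 0 < (16 * Real.pi ^ 2) ^ 2 := by positivity
  exact div_nonneg (by linarith) hπ.le

/-- The two-loop profile diverges along every scaling sequence when `b₀ > 0`, `b₁ ≥ 0`:
`afBeta N_f Λ a_k → +∞` as `a_k → 0⁺` (`Λ > 0`). -/
theorem tendsto_afBeta_atTop_of_coeff {Nf : ℕ} (hb0 : 0 < betaCoeff₀ Nf) (hb1 : 0 ≤ betaCoeff₁ Nf)
    {a : ℕ → ℝ} (ha : ∀ k, 0 < a k) (ha₀ : Tendsto a atTop (𝓝 0)) {Λ : ℝ} (hΛ : 0 < Λ) :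
    Tendsto (fun k => afBeta Nf Λ (a k)) atTop atTop := by
  have hu : Tendsto (fun k => 1 / (a k ^ 2 * Λ ^ 2)) atTop atTop := by
    simp only [one_div]
    refine tendsto_inv_nhdsGT_zero.comp ?_
    refine tendsto_nhdsWithin_iff.2 ⟨?_, Eventually.of_forall fun k => ?_⟩
    · simpa using (ha₀.pow 2).mul_const (Λ ^ 2)
    · exact Set.mem_Ioi.2 (by have := ha k; positivity)
  have hlog := Real.tendsto_log_atTop.comp hu
  have hmain : Tendsto (fun k => 2 * betaCoeff₀ Nf * Real.log (1 / (a k ^ 2 * Λ ^ 2))) atTop atTop :=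
    Tendsto.const_mul_atTop (by positivity) hlog
  refine tendsto_atTop_mono' atTop ?_ hmain
  filter_upwards [hlog.eventually_ge_atTop 1] with k hk
  unfold afBeta
  have hll : 0 ≤ Real.log (Real.log (1 / (a k ^ 2 * Λ ^ 2))) := Real.log_nonneg hk
  have : 0 ≤ 2 * (betaCoeff₁ Nf / betaCoeff₀ Nf) * Real.log (Real.log (1 / (a k ^ 2 * Λ ^ 2))) :=
    mul_nonneg (mul_nonneg zero_le_two (div_nonneg hb1 hb0.le)) hll
  linarith

/-- **(i)** Asymptotic scaling of the mass-independent scheme forces `β_k ≥ 0` eventually (`N_f ≤ 8`). -/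
theorem eventually_beta_nonneg_of_scaling {Nf : ℕ} (hNf : Nf ≤ 8) (reg : QCDRegularisation Nf)
    (has : (reg.scheme 0 0 0).HasAsymptoticScaling) : ∀ᶠ k : ℕ in atTop, 0 ≤ reg.β k := by
  obtain ⟨Λ, hΛ, hΛt⟩ := has
  have haf : Tendsto (fun k => afBeta Nf Λ (reg.a k)) atTop atTop :=
    tendsto_afBeta_atTop_of_coeff
      (Summit.QuantumFields.QCD.Theorems.betaCoeff₀_pos_of_le_sixteen (hNf.trans (by norm_num)))
      (betaCoeff₁_nonneg_of_le_eight' hNf) reg.a_pos reg.tendsto_a hΛ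
  have h : Tendsto (fun k => ((reg.scheme 0 0 0).β k - afBeta Nf Λ ((reg.scheme 0 0 0).a k)) +
      afBeta Nf Λ (reg.a k)) atTop atTop := hΛt.add_atTop haf
  have h' : Tendsto (fun k => reg.β k) atTop atTop :=
    h.congr fun k => by change reg.β k - afBeta Nf Λ (reg.a k) + afBeta Nf Λ (reg.a k) = reg.β k; ring
  exact h'.eventually_ge_atTop 0

/-- **(iii)** The torus half-sides are eventually `≥ 1` (`a_k L_k → ∞` and `L_k = 0 ⇒ a_k L_k = 0`). -/
theorem eventually_one_le_L {Nf : ℕ} (reg : QCDRegularisation Nf) : ∀ᶠ k : ℕ in atTop, 1 ≤ reg.L k := by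
  filter_upwards [reg.tendsto_L.eventually_gt_atTop 0] with k hk
  refine Nat.one_le_iff_ne_zero.2 fun h => ?_
  rw [h, Nat.cast_zero, mul_zero] at hk
  exact lt_irrefl _ hk

/-! ## The registered stub, conditional on the named fact -/

/-- **Lattice QCD reflection positivity on the branch, GIVEN the published site-reflection positivity of
Wilson lattice QCD** (`WilsonQCDSiteReflectionPositivityAP`): the registered signature of `stub_latticeQCDRP`
verbatim.  With all valence masses eventually on the physical branch `m_f(k) > −1` and `β_k ≥ 0` eventually
(asymptotic scaling of `reg.scheme 0 0 0`, whose `β`, `a` are `reg.β`, `reg.a` by `rfl`), the fact applies on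
every odd torus `2S+1 ≥ 2L_k+1 ≥ 3`, eventually in `k`. -/
theorem stub_latticeQCDRP_of_fact :
    WilsonQCDSiteReflectionPositivityAP → ∀ Nf : ℕ, (Nf = 2 ∨ Nf = 3) → ∀ reg : QCDRegularisation Nf,
      (reg.scheme 0 0 0).HasAsymptoticScaling →
        ∀ m : Fin Nf → ℝ,
          (∀ fl : Fin Nf, ∀ᶠ k : ℕ in atTop, -1 < reg.mcrit k + reg.a k * m fl / reg.Zm k) →
            ∀ᶠ k : ℕ in atTop, ∀ S : ℕ, reg.L k ≤ S →
              ∀ (R : ℕ) (A : QCDLatticeObservable Nf R), A.IsPositiveTime → A.LinksEndBy S → 2 * R < 2 * S + 1 →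
                0 ≤ (qcdTorusExpectAP (reg.β k) (2 * S + 1) (fun f => reg.mcrit k + reg.a k * m f / reg.Zm k)
                        (fun U => A.onTorus (2 * S + 1) 0 U * A.osAdjoint.onTorus (2 * S + 1) 0 U)).re ∧
                  (qcdTorusExpectAP (reg.β k) (2 * S + 1) (fun f => reg.mcrit k + reg.a k * m f / reg.Zm k)
                      (fun U => A.onTorus (2 * S + 1) 0 U * A.osAdjoint.onTorus (2 * S + 1) 0 U)).im = 0 := by
  intro hRP Nf hNf reg has m hbr
  have hNf8 : Nf ≤ 8 := by rcases hNf with rfl | rfl <;> norm_num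
  have hβ : ∀ᶠ k : ℕ in atTop, 0 ≤ reg.β k := eventually_beta_nonneg_of_scaling hNf8 reg has
  have hm : ∀ᶠ k : ℕ in atTop, ∀ fl : Fin Nf, -1 < reg.mcrit k + reg.a k * m fl / reg.Zm k :=
    eventually_all.2 hbr
  filter_upwards [hβ, hm, eventually_one_le_L reg] with k hβk hmk hLk S hS R A hA hAS hR
  exact hRP Nf (reg.β k) S (fun f => reg.mcrit k + reg.a k * m f / reg.Zm k) hβk hmk (hLk.trans hS) R A hA hAS hR

end Summit.QuantumFields.QCD.Cruxes.SeaFactorisationBridge.ProperTimeQuarantine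

end
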